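import Summits.CriticalPhenomena.PercolationContinuityZ3.Theorems.PercNearOneGluingNoHeavyLowerTailKnQuestion8CoefficientwiseCoreClassKernelMixReducedKleitman

/-!
# The two-stage product matching: bijectivity and the row projection of collisions

Support file (`--supports stmt-CriticalPhenomena-4575`, closed), prover `prim-cplus-coupling` (gen 66).  No notations, no named facts,
no definitions, no sorries; standard axioms.  Memo `prim-cplus-coupling/A5-COUPLING-gen66.md`
§1.2–1.3 (the CONSTRUCTION).

On a product `Z = X × Y` with coordinatewise 'mirror' maps `cX, cY`, a level `W ⊆ X × Y` has FIBRES `W^x = {y | (x,y) ∈ W}` and ROWS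
`W_v = {x | (x,v) ∈ W}`.  Given INNER maps `φ x : Y → Y` sending each fibre `W^x` increasingly and injectively into its mirror
(`cY (φ x y) ∈ W^x`) and OUTER maps `Ψ y* : X → X` sending each row `W_{cY y*}` increasingly and injectively into its mirror, the
TWO-STAGE map `Φ(x,y) = (Ψ_{y*} x, y*)`, `y* = φ x y` (written out componentwise below), sends `W` increasingly and injectively into its mirror (`two_stage_increasing`,
`two_stage_mirror`, `two_stage_injOn`).  For two levels `D, B` with two-stage maps `Φ^D, Φ^B` the collisions `Φ^D z₁ = Φ^B z₂` of a
fixed row `v` project injectively onto collisions of the outer maps of that row (`row_projection_card_le`), so a counting bound for the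
outer (row) collisions transfers to the row of `Z`-collisions (`row_bound_of_outer`) — the hypothesis `hX` of `TwoStageCharging.two_stage_charging`.
[cite: KozmaNitzan2024, Questions 8–9 (§5.5 p. 36) (context); Harris 1960; Kleitman 1966]
-/

namespace Summit.CriticalPhenomena.PercolationContinuityZ3.Theorems.Coefficientwise.TwoStageProduct

open Finset ReducedKleitman

variable {X Y : Type*}

section Order

variable [Preorder X] [Preorder Y]

/-- **The two-stage map is increasing on the level.** -/
theorem two_stage_increasing (W : Finset (X × Y)) (cX : X → X) (cY : Y → Y) (φ : X → Y → Y) (Ψ : Y → X → X)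
    (hin : ∀ x y, (x, y) ∈ W → y ≤ φ x y ∧ (x, cY (φ x y)) ∈ W)
    (hout : ∀ v x, (x, cY v) ∈ W → x ≤ Ψ v x ∧ (cX (Ψ v x), cY v) ∈ W)
    (z : X × Y) (hz : z ∈ W) : z ≤ (Ψ (φ z.1 z.2) z.1, φ z.1 z.2) := by
  obtain ⟨x, y⟩ := z
  obtain ⟨hy, hrow⟩ := hin x y hz
  obtain ⟨hx, _⟩ := hout (φ x y) x hrow
  exact Prod.mk_le_mk.mpr ⟨hx, hy⟩

end Order

/-- **The two-stage map lands in the mirror of the level**: `(cX (Φ z).1, cY (Φ z).2) ∈ W`. -/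
theorem two_stage_mirror [LE X] [LE Y] (W : Finset (X × Y)) (cX : X → X) (cY : Y → Y) (φ : X → Y → Y) (Ψ : Y → X → X)
    (hin : ∀ x y, (x, y) ∈ W → (x, cY (φ x y)) ∈ W)
    (hout : ∀ v x, (x, cY v) ∈ W → (cX (Ψ v x), cY v) ∈ W)
    (z : X × Y) (hz : z ∈ W) : (cX (Ψ (φ z.1 z.2) z.1), cY (φ z.1 z.2)) ∈ W := by
  obtain ⟨x, y⟩ := z
  exact hout (φ x y) x (hin x y hz)

/-- **The two-stage map is injective on the level.** -/
theorem two_stage_injOn (W : Finset (X × Y)) (cY : Y → Y) (φ : X → Y → Y) (Ψ : Y → X → X)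
    (hin : ∀ x y, (x, y) ∈ W → (x, cY (φ x y)) ∈ W)
    (hin_inj : ∀ x y y', (x, y) ∈ W → (x, y') ∈ W → φ x y = φ x y' → y = y')
    (hout_inj : ∀ v x x', (x, cY v) ∈ W → (x', cY v) ∈ W → Ψ v x = Ψ v x' → x = x')
    (z z' : X × Y) (hz : z ∈ W) (hz' : z' ∈ W) (h : (Ψ (φ z.1 z.2) z.1, φ z.1 z.2) = (Ψ (φ z'.1 z'.2) z'.1, φ z'.1 z'.2)) : z = z' := by
  obtain ⟨x, y⟩ := z
  obtain ⟨x', y'⟩ := z'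
  simp only [Prod.mk.injEq] at h
  obtain ⟨hΨ, hφ⟩ := h
  -- common row v := φ x y = φ x' y'
  have hr : (x, cY (φ x y)) ∈ W := hin x y hz
  have hr' : (x', cY (φ x y)) ∈ W := by rw [hφ]; exact hin x' y' hz'
  have hΨ' : Ψ (φ x y) x = Ψ (φ x y) x' := by
    calc Ψ (φ x y) x = Ψ (φ x' y') x' := hΨ
      _ = Ψ (φ x y) x' := by rw [hφ]
  have hx : x = x' := hout_inj (φ x y) x x' hr hr' hΨ'
  subst hx
  have hy : y = y' := hin_inj x y y' hz hz' hφ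
  subst hy
  rfl

section Rows

variable [Fintype X] [DecidableEq X] [DecidableEq Y]

open Classical in
/-- **Row projection of collisions is injective.**  For two levels `D, B` with two-stage maps (inner `φD, φB`, outer `ΨD, ΨB`), the
collisions `Φ^D z₁ = Φ^B z₂` with target row `v` project injectively, via `(z₁,z₂) ↦ (z₁.1, z₂.1)`, into the collisions of the outer
maps of row `v` on the row levels `D_{cY v} × B_{cY v}`; hence any property of the `X`-components is counted at most as often. -/
theorem row_projection_card_le (D B : Finset (X × Y)) (cY : Y → Y) (φD φB : X → Y → Y) (ΨD ΨB : Y → X → X)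
    (hinD : ∀ x y, (x, y) ∈ D → (x, cY (φD x y)) ∈ D) (hinB : ∀ x y, (x, y) ∈ B → (x, cY (φB x y)) ∈ B)
    (hinD_inj : ∀ x y y', (x, y) ∈ D → (x, y') ∈ D → φD x y = φD x y' → y = y')
    (hinB_inj : ∀ x y y', (x, y) ∈ B → (x, y') ∈ B → φB x y = φB x y' → y = y')
    (v : Y) (good : X → X → Prop) :
    (((D ×ˢ B).filter (fun c => (ΨD (φD c.1.1 c.1.2) c.1.1, φD c.1.1 c.1.2) = (ΨB (φB c.2.1 c.2.2) c.2.1, φB c.2.1 c.2.2) ∧ φD c.1.1 c.1.2 = v)).filter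
        (fun c => good c.1.1 c.2.1)).card ≤
      (((fibR D (cY v) ×ˢ fibR B (cY v)).filter (fun p => ΨD v p.1 = ΨB v p.2)).filter
        (fun p => good p.1 p.2)).card := by
  refine card_le_card_of_injOn (fun c => (c.1.1, c.2.1)) ?_ ?_
  · intro c hc
    rw [mem_coe, mem_filter, mem_filter, mem_product] at hc
    have hD : (c.1.1, c.1.2) ∈ D := by simpa using hc.1.1.1
    have hB : (c.2.1, c.2.2) ∈ B := by simpa using hc.1.1.2
    have hcoll := hc.1.2.1
    have hrow := hc.1.2.2
    have hg := hc.2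
    simp only [Prod.mk.injEq] at hcoll hrow
    obtain ⟨hΨ, hφ⟩ := hcoll
    rw [mem_coe, mem_filter, mem_filter, mem_product, mem_fibR, mem_fibR]
    refine ⟨⟨⟨?_, ?_⟩, ?_⟩, hg⟩
    · have h := hinD c.1.1 c.1.2 hD
      rwa [hrow] at h
    · have h := hinB c.2.1 c.2.2 hB
      rwa [← hφ, hrow] at h
    · have h : ΨD (φD c.1.1 c.1.2) c.1.1 = ΨB (φB c.2.1 c.2.2) c.2.1 := hΨ
      rwa [← hφ, hrow] at h
  · intro c hc c' hc' h
    rw [mem_coe, mem_filter, mem_filter, mem_product] at hc hc'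
    have hD : (c.1.1, c.1.2) ∈ D := by simpa using hc.1.1.1
    have hB : (c.2.1, c.2.2) ∈ B := by simpa using hc.1.1.2
    have hD' : (c'.1.1, c'.1.2) ∈ D := by simpa using hc'.1.1.1
    have hB' : (c'.2.1, c'.2.2) ∈ B := by simpa using hc'.1.1.2
    have hcoll := hc.1.2.1
    have hrow := hc.1.2.2
    have hcoll' := hc'.1.2.1
    have hrow' := hc'.1.2.2
    simp only [Prod.mk.injEq] at hcoll hrow hcoll' hrow'
    obtain ⟨_, hφ⟩ := hcoll
    obtain ⟨_, hφ'⟩ := hcoll'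
    simp only [Prod.mk.injEq] at h
    obtain ⟨hx1, hx2⟩ := h
    -- rows: φD c.1.1 c.1.2 = v = φD c'.1.1 c'.1.2 with equal X-components ⇒ equal Y-components
    have e1 : c.1 = c'.1 := by
      have hD'' : (c.1.1, c'.1.2) ∈ D := by rw [hx1]; exact hD'
      have heq : φD c.1.1 c.1.2 = φD c.1.1 c'.1.2 := by rw [hrow]; nth_rewrite 1 [hx1]; rw [hrow']
      exact Prod.ext hx1 (hinD_inj c.1.1 c.1.2 c'.1.2 hD hD'' heq)
    have e2 : c.2 = c'.2 := by
      have hB'' : (c.2.1, c'.2.2) ∈ B := by rw [hx2]; exact hB'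
      have hv2 : φB c.2.1 c.2.2 = v := by rw [← hφ, hrow]
      have hv2' : φB c'.2.1 c'.2.2 = v := by rw [← hφ', hrow']
      have heq : φB c.2.1 c.2.2 = φB c.2.1 c'.2.2 := by rw [hv2]; nth_rewrite 1 [hx2]; rw [hv2']
      exact Prod.ext hx2 (hinB_inj c.2.1 c.2.2 c'.2.2 hB hB'' heq)
    exact Prod.ext e1 e2

open Classical in
/-- **Row bound from the outer bound** (the hypothesis `hX` of `two_stage_charging`).  If the outer collisions of row `v` satisfy the
H-bound `#{(x₁,x₂) : ΨD x₁ = ΨB x₂, ↑x₁ ∩ ↑x₂ ⊆ U} ≤ #(U ∩ NFX)`, then so do the `Z`-collisions whose target row is `v`. -/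
theorem row_bound_of_outer [Preorder X] (D B : Finset (X × Y)) (cY : Y → Y) (φD φB : X → Y → Y) (ΨD ΨB : Y → X → X)
    (hinD : ∀ x y, (x, y) ∈ D → (x, cY (φD x y)) ∈ D) (hinB : ∀ x y, (x, y) ∈ B → (x, cY (φB x y)) ∈ B)
    (hinD_inj : ∀ x y y', (x, y) ∈ D → (x, y') ∈ D → φD x y = φD x y' → y = y')
    (hinB_inj : ∀ x y y', (x, y) ∈ B → (x, y') ∈ B → φB x y = φB x y' → y = y')
    (NFX : Finset X) (v : Y) (U : Finset X)
    (hH : (((fibR D (cY v) ×ˢ fibR B (cY v)).filter (fun p => ΨD v p.1 = ΨB v p.2)).filter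
        (fun p => ∀ q : X, p.1 ≤ q → p.2 ≤ q → q ∈ U)).card ≤ (U ∩ NFX).card) :
    (((D ×ˢ B).filter (fun c => (ΨD (φD c.1.1 c.1.2) c.1.1, φD c.1.1 c.1.2) = (ΨB (φB c.2.1 c.2.2) c.2.1, φB c.2.1 c.2.2) ∧ φD c.1.1 c.1.2 = v)).filter
        (fun c => ∀ q : X, c.1.1 ≤ q → c.2.1 ≤ q → q ∈ U)).card ≤ (U ∩ NFX).card := by
  have h := row_projection_card_le D B cY φD φB ΨD ΨB hinD hinB hinD_inj hinB_inj v
    (fun a b => ∀ q : X, a ≤ q → b ≤ q → q ∈ U)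
  refine le_trans ?_ hH
  convert h using 2
  all_goals first | rfl | (congr 1)

end Rows

end Summit.CriticalPhenomena.PercolationContinuityZ3.Theorems.Coefficientwise.TwoStageProduct
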